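import Literature.Barriers.MatrixMultiplication.RectangularBarrierProofs
import Literature.Computability.AlgebraicComplexity.RectangularExponentAlpha
import Literature.Computability.AlgebraicComplexity.RectangularExponentBounds
import HarnessLib

/-!
# Real rungs: `ω ≤ 6/(2+α)` and `ω(1,1,k) = k+1 ⟹ ω ≤ 3(k+1)/(k+2)` over every field

Solo-informed seat, gen 31 (s1, seventh file) — thin corollaries recording, in the form used by
the seat's ladder bookkeeping, the REAL-exponent symmetrization inequality that is already in the
tree as `Literature.Barriers.MatrixMultiplication.omega_mul_le_three_mul_omegaRect`
(`(2 + a)·ω ≤ 3·ω(1,a,1)` for every real `a`; CLLZ 2025 Rem. 3.23, proved there) and its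
consequence `CLLZ2025_rem323_holds` (`ω + ωα/2 ≤ 3`):

* `omega_le_six_div_of_left_rung_real`: `ω(1,a,1) = 2 ⟹ ω ≤ 6/(2+a)` (`-2 < a`);
* **`omega_le_six_div_two_add_dualExponentAlpha`: `ω ≤ 6/(2+α)`** (every field) and the
  certificate form `omega_le_six_div_of_le_dualExponentAlpha`: `0 ≤ a ≤ α ⟹ ω ≤ 6/(2+a)`;
* `six_div_two_add_le_three_sub`: `6/(2+a) ≤ 3 − a` on `[0,1]` (symmetrization dominates the
  blocking bound `ω ≤ 3 − α` of `SoloInformedLadderLipschitz`);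
* `omega_mul_le_three_mul_omegaRect_one_one_real`: `(2 + k)·ω ≤ 3·ω(1,1,k)` (real `k`), and
  `omega_le_of_right_rung_real`: `ω(1,1,k) = k + 1 ⟹ ω ≤ 3(k+1)/(k+2)` for every real `k > -2`
  (`k = 2`: `9/4`; `k = 3`: `12/5`) — the real form of `omega_le_of_right_rung_nat` of
  `SoloInformedLadderSymmetrization`.

[cite: ChristandlLeGallLysikovZuiddam2025, Rem. 3.23] [cite: Blaser2013, Theorem 5.9]
-/

set_option linter.dupNamespace false

namespace Summit.MatrixMultiplication.MatrixMultiplication.Theorems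

open Literature.Computability.AlgebraicComplexity
open Literature.Barriers.MatrixMultiplication (omega_mul_le_three_mul_omegaRect CLLZ2025_rem323_holds)

variable (K : Type) [Field K]

/-- **A real left rung pays `6/(2+a)`**: `ω(1,a,1) = 2 ⟹ ω ≤ 6/(2+a)` (`-2 < a`).
[cite: ChristandlLeGallLysikovZuiddam2025, Rem. 3.23] -/
theorem omega_le_six_div_of_left_rung_real {a : ℝ} (ha : -2 < a) (h : omegaRect K 1 a 1 = 2) :
    omega K ≤ 6 / (2 + a) := by
  have hs := omega_mul_le_three_mul_omegaRect K a
  rw [h] at hs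
  rw [le_div_iff₀ (by linarith)]
  linarith

/-- **`ω ≤ 6/(2+α)` over every field** (CLLZ Rem. 3.23 `ω + ωα/2 ≤ 3`, solved for `ω`).
[cite: ChristandlLeGallLysikovZuiddam2025, Rem. 3.23] -/
theorem omega_le_six_div_two_add_dualExponentAlpha :
    omega K ≤ 6 / (2 + dualExponentAlpha K) := by
  have h := CLLZ2025_rem323_holds K
  have hα0 := dualExponentAlpha_nonneg K
  rw [le_div_iff₀ (by linarith)]
  linarith

/-- Certificate form: `0 ≤ a ≤ α ⟹ ω ≤ 6/(2+a)`. [cite: ChristandlLeGallLysikovZuiddam2025, Rem. 3.23] -/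
theorem omega_le_six_div_of_le_dualExponentAlpha {a : ℝ} (ha0 : 0 ≤ a)
    (ha : a ≤ dualExponentAlpha K) : omega K ≤ 6 / (2 + a) := by
  refine (omega_le_six_div_two_add_dualExponentAlpha K).trans ?_
  gcongr

/-- Symmetrization dominates blocking: `6/(2+a) ≤ 3 − a` for `0 ≤ a ≤ 1`. -/
theorem six_div_two_add_le_three_sub {a : ℝ} (ha0 : 0 ≤ a) (ha1 : a ≤ 1) :
    6 / (2 + a) ≤ 3 - a := by
  rw [div_le_iff₀ (by linarith)]
  nlinarith

/-- **`(2 + k)·ω ≤ 3·ω(1,1,k)`** for every real `k` (the tree's `(2+a)ω ≤ 3ω(1,a,1)` moved to the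
right exponent by `ω(1,k,1) = ω(1,1,k)`). [cite: ChristandlLeGallLysikovZuiddam2025, Rem. 3.23] -/
theorem omega_mul_le_three_mul_omegaRect_one_one_real (k : ℝ) :
    (2 + k) * omega K ≤ 3 * omegaRect K 1 1 k := by
  rw [← omegaRect_one_mid_one K]
  exact omega_mul_le_three_mul_omegaRect K k

/-- **A real right rung pays `3(k+1)/(k+2)`**: `ω(1,1,k) = k + 1 ⟹ ω ≤ 3(k+1)/(k+2)` (`-2 < k`;
`k = 1`: `2`, `k = 2`: `9/4`, `k = 3`: `12/5`). [cite: Blaser2013, Theorem 5.9] -/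
theorem omega_le_of_right_rung_real {k : ℝ} (hk : -2 < k) (h : omegaRect K 1 1 k = k + 1) :
    omega K ≤ 3 * (k + 1) / (k + 2) := by
  have hs := omega_mul_le_three_mul_omegaRect_one_one_real K k
  rw [h] at hs
  rw [le_div_iff₀ (by linarith)]
  linarith

/-- Upper-bound form: `ω(1,1,k) ≤ u ⟹ ω ≤ 3u/(k+2)` (`-2 < k`), e.g. with a rectangular table row.
[cite: Blaser2013, Theorem 5.9] -/
theorem omega_le_of_omegaRect_one_one_le {k u : ℝ} (hk : -2 < k) (h : omegaRect K 1 1 k ≤ u) :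
    omega K ≤ 3 * u / (k + 2) := by
  have hs := omega_mul_le_three_mul_omegaRect_one_one_real K k
  rw [le_div_iff₀ (by linarith)]
  linarith

end Summit.MatrixMultiplication.MatrixMultiplication.Theorems
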